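import Summits.CriticalPhenomena.Ising3D.ExclusionSentencesControl2DTrgGammaFin

/-!
# Exclusion sentences — 2D-control instance of the FULL `TRG` checker at `Δ_ε = 1`, part 1 of 2
(cell `pub-ising3x`, seat recog-1)

HONEST FRAMING: lottery ticket; floor = tightest certified 3D Ising CFT bounds; no exact-solution
claim without a proof.

Companion of `ExclusionSentencesControl2DTrgGamma(Fin).lean` (`Δ_σ = 1/8`).  `Δ_ε = 1` (SCOPE.md §4) against the WHOLE
FAMILIES-v1 family `TRG` (`D ≤ 17`, `h ≤ 32`): the COMPLETE member list within `10⁻⁵` of `1` has FIVE monomials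
(`controlEpsTrgGEx`): `(13/24)·π^{3/2}ζ(3)/Γ(¼)`, `(24/13)·Γ(¼)/(π^{3/2}ζ(3))`, `(18/5)·√2·π·ζ(3)/Γ(⅓)³`,
`(7/31)·π²ζ(3)/Γ(⅓)`, `(31/7)·Γ(⅓)/(π²ζ(3))` — note the two reciprocal pairs: a member `x ≈ 1` always comes with
`1/x ≈ 1` inside the table (exclusion data failing R2, §3.4; the `Γ`-free part is EMPTY at this width,
`trgExcluded_control_eps`).  This file: tuple list + parts `0–3`; `…TrgGammaEpsFin.lean`: parts `4–7`, assembly,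
printed shape.  Python twin `tools/trg_gamma_exceptions.py` gives the same five tuples.  No 3D digit is used anywhere.
-/

namespace Summit.CriticalPhenomena.Ising3D

/-- The full-TRG members within `10⁻⁵` of `1`, as tuples `(p, q, u, a, g, b, L, s)`. -/
def controlEpsTrgGEx : List (ℕ × ℕ × ℕ × ℤ × ℕ × ℤ × ℕ × ℤ) :=
  [(13, 24, 0, 3, 0, -1, 2, 1), (24, 13, 0, -3, 0, 1, 2, -1), (18, 5, 1, 2, 1, -3, 2, 1), (7, 31, 0, 4, 1, -1, 2, 1), (31, 7, 0, -4, 1, 1, 2, -1)]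

/-- Part 0 of the full-TRG sentence on `[1 − 10⁻⁵, 1 + 10⁻⁵]`. -/
theorem trgFull_control_eps_p0 :
    trgFullPart 17 32 0 (1 - 1 / 10 ^ 5) (1 + 1 / 10 ^ 5) controlEpsTrgGEx = true := by
  decide +kernel

/-- Part 1 of the full-TRG sentence on `[1 − 10⁻⁵, 1 + 10⁻⁵]`. -/
theorem trgFull_control_eps_p1 :
    trgFullPart 17 32 1 (1 - 1 / 10 ^ 5) (1 + 1 / 10 ^ 5) controlEpsTrgGEx = true := by
  decide +kernel

/-- Part 2 of the full-TRG sentence on `[1 − 10⁻⁵, 1 + 10⁻⁵]`. -/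
theorem trgFull_control_eps_p2 :
    trgFullPart 17 32 2 (1 - 1 / 10 ^ 5) (1 + 1 / 10 ^ 5) controlEpsTrgGEx = true := by
  decide +kernel

/-- Part 3 of the full-TRG sentence on `[1 − 10⁻⁵, 1 + 10⁻⁵]`. -/
theorem trgFull_control_eps_p3 :
    trgFullPart 17 32 3 (1 - 1 / 10 ^ 5) (1 + 1 / 10 ^ 5) controlEpsTrgGEx = true := by
  decide +kernel

end Summit.CriticalPhenomena.Ising3D
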